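import Mathlib
import HarnessLib
import HarnessLib.Audit
import Summits.CriticalPhenomena.Statement
import Literature.Probability.Percolation.CardyFormula
import HarnessLib.Audit.Status.Attr

/-!
Route: CardyCapacityWard

DORMANT since 2026-08-24T07:57:07Z (reconciler: no traction for 6.6 d (last activity item-evidence-added at 2026-08-17T16:53:14Z); parked, not closed — `ledger route dormant route-CriticalPhenomena-CardyCapacityWard --off` to reactivate) — unstaffed, not closed; items shared with open routes are served there. `ledger route dormant <id> --off` reactivates.

# Route CardyCapacityWard — boundary Ward identity on the lattice half-plane (hull removal =
hydrodynamic mark shift, charge = hcap) + flat-marked covariance via tubes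

It suffices to show X = FlatMarkedCovariance: there is ONE function f, continuous on (0,1), such
that for every
conformal rectangle R whose carrier lies in the upper half-plane and contains an upper half-ball
around each of its
four marked points (so the marks are real and the boundary is a flat lattice line near them), the
bond-ℤ² crossing
probability bondDomainCrossingProb R δ converges to f(η(R)) as δ → 0⁺. This is X_U of route
CardyUniqueLimit
restricted to FLAT-MARKED rectangles — the class on which the Hadamard/Russo calculus of card
capacity-sum-rule
operates (mark derivatives are clean boundary 2-arm events, hull removals are boundary 3-arm events
on a lattice
half-plane) — and thin tubes hanging from the marks of an arbitrary rectangle down to a common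
baseline reduce the
general case to it (crux TubeReduction). The card's mechanism is filed as the two local cruxes every
proof of X by
domain variation must pass through: BoundaryWardIdentity (removing a small boundary hull changes the
crossing
probability exactly as the hydrodynamic (Loewner) shift of the marks does, to order hcap) and its
mark-free shadow
CapacityCharge (the 3-arm response sees the hull only through its half-plane capacity; half-disc : K
= 1 : hcap K).
Lean: `∃ f : ℝ → ℝ, ContinuousOn f (Set.Ioo 0 1) ∧ ∀ R :
Literature.Probability.RandomPlanarGeometry.ConformalRectangle, R.carrier ⊆
UpperHalfPlane.upperHalfPlaneSet → (∀ i, ∃ ρ > 0, Metric.ball (R.pt i) ρ ∩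
UpperHalfPlane.upperHalfPlaneSet ⊆ R.carrier) → R.HasCrossingLimit
(Literature.Probability.Percolation.bondDomainCrossingProb R) f`

## Assembly
Deciding theorem `closes` (re-certified at the 2026-08-16 route-choice repair; crux/target
hypotheses only, as the
gate requires): FlatMarkedCovariance → TubeReduction → CardyRigidity → CardyFormulaZ2 —
TubeReduction turns the target
into X_U = ∃ f ∀ R, HasCrossingLimit; CardyRigidity gives EqOn f cardyFunction (Ioo 0 1); for R, φ,
x uniformizing,
crossRatio x ∈ (0,1) by ConformalRectangle.crossRatio_mem_Ioo_of_isUniformizing, so the limit f(η)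
rewrites to F(η),
which is CardyFormulaZ2. The target itself is REACHED INSIDE THE ROUTE by the support glue chain
filed at the same
repair: WardIntegration : HydroUniformizer → FaceWard → HalfPlaneMobius → HullCovariance (integrate
the face Ward
identity slab by slab from the half-plane, image marks fixed, marked arcs transported by the
hydrodynamic
uniformizers) and JordanBridge : HydroUniformizer → HullCovariance → FlatMarkedCovariance (sandwich
a flat-marked
Jordan rectangle between rectilinear hull complements; RSW only at the four flat marks; Carathéodory
convergence of
cross-ratios), with FaceWard (crux 6) the load-bearing premise and HydroUniformizer the isolated
classical input
(Lawler2005 Prop 3.36, Pommerenke1992 Thm 2.1). BoundaryWardIdentity and CapacityCharge remain the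
local layer of the
target (X ⇒ r2 ⇒ r3 by first-order Loewner calculus and RSW-Lipschitz continuity in the marks): the
point identity and
its mark-free charge are the cheapest decisive tests of the line and the intended engine of
FaceWard's proof; the
legacy Assembly item (FlatMarkedCovariance → TubeReduction → CardyRigidity → CardyFormulaZ2) is
literally `closes`
and stays as a trivially provable support edge.

Rationale: WHY THIS LINE. Conformal invariance of crossing probabilities is, rectangle by rectangle, a
statement about first variations:
Russo's formula makes the response to deleting boundary cells an exact boundary 3-arm (pivotal) sum
and the
response to moving a mark an exact boundary 2-arm sum, with the universal half-plane exponents 2 and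
1 known on ℤ²
by RSW/counting (SmirnovWernerMRL2001, Nolin2008 §4.6, WernerPCMI2009); in the continuum the same
variation is the
boundary Ward identity of restriction/CLE theories (FriedrichWerner2003 Prop. 1: removing the slit
[x,x+iε√2] of
capacity ε² acts through φ(z) = z + ε²(1/(z−x)+1/x); arXiv:math-ph/0511054, arXiv:1209.1560: the
stress tensor IS the
rescaled small-hull response). The route uses Loewner/half-plane-capacity calculus (Lawler2005 §3.4)
as the bookkeeping of that identity, written INLINE in
the cruxes since the cone repair of 2026-08-15 (bounded hull = bounded ∧ closure(K∩ℍ) = K ∧ ℍ∖K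
simply connected; hydrodynamic
normalisation φ(w) − w → 0 at ∞ in ℍ∖K; capacity = the limit c of w(φ(w) − w), Lawler Def. 3.37 —
verbatim the bodies of the tree's
`IsBoundedHull`, `IsHydrodynamicMap` and the limit form of `hcap`, so that the route file imports
Percolation.CardyFormula only and
no RestrictionMeasures/CritPercSLE fact rides into its cone), and states it LATTICE-SIDE and
derivative-free — "removing z+εK from ℍ∖L equals, to o(ε²), shifting the marks by
g_L⁻¹∘g_{L∪(z+εK)}" — so that no
regularity of subsequential limits is presupposed (the refuter's caveat (i) on the card), with the
capacity sum rule
(caveat (iv): factorisation is a separate thing) isolated as the mark-free, Monte-Carlo-testable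
crux. What no prior
route does: CardyUniqueLimit/ViaSLE6/RotToConf posit symmetry upgrades of curve or crossing laws,
HarmonicInvariants/
DiscreteHolo an observable, Isoradial a transport; here the unknown is a boundary RESPONSE
functional with an
explicit conformal target, and the target class is cut down to flat-marked domains by an RSW tube
surgery.

RANKED CRUXES. #0 FlatMarkedCovariance (target) — one continuous f on (0,1) gives the δ → 0⁺ limit
f(η) of bond-ℤ² crossing probabilities for every conformal rectangle contained in ℍ with an upper
half-ball around each mark inside the domain (flat-marked rectangles). (why it might fail: it is
conformal invariance + existence of the limit for a subclass: fails iff ℤ² crossing limits are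
non-unique or only shear-covariant (EmbeddingModulusUniqueness); as typed it inherits any
G02-discretisation pathology of CardyFormulaZ2 itself.) [Smirnov2001, Beffara2008Universal,
BollobasRiordan2006, Schramm2000]
#2 BoundaryWardIdentity (crux) — (card items (2)+(4), covariant and derivative-free) on the lattice
half-plane with a fat bounded hull L removed (crude discretisation embDomainCrossing of ℍ∖L, marks x
real, marked arcs [x₀,x₁],[x₂,x₃] off L), let z be a boundary point of ℍ∖L flat at scale ρ in one of
the four axis orientations τ (τ⁴=1), at distance ≥ ρ from both CLOSED marked arcs (restated
2026-08-15 after refuter rreview f884a1c3: with metric discrete arcs a hull sitting on a marked arc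
leaves a Θ(ε²) 3-arm deficit, so 'away from the marks' was mis-stated), and K ⊆ B̄(0,1) a fat hull
shape. Then for ε small, removing z+ετK changes the crossing probability, up to η·ε², exactly as
replacing the marks x by x' := g_L⁻¹(g_{L∪(z+ετK)}(x)) (hydrodynamically normalised conformal maps,
inlined, and their boundary values) does: |P_δ(ℍ∖(L∪(z+ετK)); x) − P_δ(ℍ∖L; x')| ≤ ηε² for all small
δ. At L = ∅, τ = 1 this is the flat boundary Ward identity "3-arm response = hcap(K)·Σ_j(2-arm
density)_j/(x_j−z)" without derivatives. [difficulty: open-problem] (why it might fail: it is CI in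
the small: the ℤ² response could carry an orientation- or L-dependent normalisation not matching
hcap-covariance (a sheared lattice does exactly that: Beffara2008Universal Prop 4); both sides are
O(ε²) only because the hp exponents are exactly 2 and 1, so any anomalous log would break it.)
[FriedrichWerner2003, DoyonRivaCardy2006, Doyon2013CLEStressTensor, Lawler2005,
GarbanPeteSchramm2013, Beffara2008Universal, Nolin2008]
#3 CapacityCharge (crux) — (card crux (2), mark-free sum rule) on the flat lattice half-plane with
real marks x and a free boundary point z, for fat hull shapes K, K' ⊆ B̄(0,1) the pivotal responses
Resp(H) := P_δ(ℍ; x) − P_δ(ℍ∖H; x) satisfy |Resp(z+εK)·c' − Resp(z+εK')·c| ≤ ηε² (δ → 0 first, then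
ε small), c = hcap K and c' = hcap K' entering as the limits of w(φ(w) − w) at ∞ for conformal φ :
ℍ∖K → ℍ (restated inline 2026-08-15; equivalent to IsHydrodynamicMap ∧ c = hcap, planner file
Faithful.lean): the boundary 3-arm response functional is proportional to half-plane capacity (unit
half-disc : K = 1 : hcap K; the card's 2 : 1 is half-disc : slit, restated for fat hulls because
vertex discretisations do not see slits). Necessary for BoundaryWardIdentity (take L = ∅ and
RSW-Lipschitz continuity in the marks); the cheapest decisive test of CI on ℤ². [difficulty: XL]
(why it might fail: the response need not factor through a mesoscopic 3-arm field (then the δ-limit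
ratio remembers K beyond hcap), or σ(K) could be another positive 2-homogeneous monotone hull
functional (e.g. capacity of a sheared hull) — hcap is forced only by CI; Monte-Carlo at r = 8..64
decides cheaply.) [FriedrichWerner2003, Lawler2005, GarbanPeteSchramm2013, arXiv:0903.4496,
SmirnovWernerMRL2001, Nolin2008, Beffara2008Universal]
#4 TubeReduction (crux) — flat-marked covariance implies X_U for ALL conformal rectangles with the
same f: hang from each mark of R a thin vertical tube down to a common baseline below R (width w ≫
δ), put the new marks at the tube bottoms; RSW one-arm bounds at the marks make the crossing
probabilities of R and of the tubed domain differ by o_w(1) uniformly in δ ≤ δ(w), Radó/Carathéodory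
continuity makes the cross-ratios differ by o_w(1), and f is continuous. [deps:
FlatMarkedCovariance] [difficulty: L] (why it might fail: X_U ranges over ALL Jordan rectangles in
G02's discretisation (largest component, closest-arc rule): a wild boundary at a mark could break
HasCrossingLimit for that R (cf. CardyUniqueLimit.NegDegenerateArcs) while flat-marked ones
converge; tube mouths perturb discrete arcs at scale w.) [BollobasRiordan2006, Pommerenke1992,
KemppainenSmirnov2017, CamiaNewman2007, Nolin2008]
#5 CardyRigidity (crux) — (shared verbatim with route CardyUniqueLimit, stmt-CriticalPhenomena-0746)
if the bond-ℤ² crossing probabilities of all conformal rectangles converge to a function f of the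
cross-ratio, then f = cardyFunction on (0,1) (crossing kernel ⇒ exploration converges to a
conformally invariant domain-Markov curve ⇒ SLE₆ by locality ⇒ Cardy). [difficulty: L] (why it might
fail: as a theorem it needs the crossing kernel in admissible non-Jordan domains with moving mesh
(CamiaNewman2007 Thm 2-3, p489) while the hypothesis is stated for fixed Jordan rectangles; false
only if a conformally invariant non-Cardy limit existed.) [CamiaNewman2007, Schramm2000,
LawlerSchrammWerner2001, Smirnov2001, Werner2007]
#6 FaceWard (crux; filed 2026-08-16, route-choice repair — the load-bearing premise of the glue
chain to the target, ranked 6 only because 2–5 were taken) — the FACE/SLAB Ward identity, uniform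
over a frame: for m boxes, size R, minimal face length ℓ₀, image marks y₀<y₁<y₂<y₃ and η > 0 there
is ε₀ such that for every fat rectilinear hull L₁ (≤ m closed boxes, ℍ∖L₁ simply connected) and
every slab S = z + τ([0,ℓ]×[0,ε]) (τ⁴ = 1, ℓ ≥ ℓ₀, ε < ε₀) with base on ∂(ℍ∖L₁) (in L₁ or on ℝ) and
open part in ℍ∖L₁, L₂ = L₁ ∪ S again a fat hull inside [−R,R]×[0,R], the crude bond-ℤ² crossing
probabilities of (ℍ∖L₂; ψ₂[y₀,y₁], ψ₂[y₂,y₃]) and (ℍ∖L₁; ψ₁[y₀,y₁], ψ₁[y₂,y₃]) — ψ_i : ℍ → ℍ∖L_i the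
hydrodynamic uniformizers (ψ_i(w) − w → 0 at ∞, i.e. g_{L_i}⁻¹, Lawler2005 Prop 3.36), arcs =
boundary-extension images — differ by at most ηε for all δ < δ₀(configuration). Marked arcs are
TRANSPORTED (bcc operators of percolation have weight 0, so the identity is CI-exact for every pair
and the integration keeps y fixed: no swallowing of real marks, dented marked arcs covered).
[difficulty: open-problem] (why it might fail: CI in the small, integrated: false iff bond-ℤ² face
responses are not hydrodynamic/hcap-covariant — a sheared embedding is not (Beffara2008Universal
Prop 4); o(ε) control at reflex corners needs the 3π/2-wedge 3-arm exponent > 1 (conjecturally 4/3,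
no ℤ² proof); arcs lying on the pushed face are included.) [FriedrichWerner2003, Lawler2005,
GarbanPeteSchramm2013, Beffara2008Universal, SmirnovWernerMRL2001, Nolin2008, DoyonRivaCardy2006]
#9 HalfPlaneMobius (crux since 2026-08-16T03:17Z, re-badged by the badge-repair unit; LOAD-BEARING —
it is the L = ∅ base of WardIntegration) — the K = ∅ instance of the hull picture and the natural
first milestone: half-plane crossing probabilities of bond-ℤ² between [x₀,x₁] and [x₂,x₃] (crude
discretisation) converge to f(crossRatio x) for one continuous f — existence of the half-plane limit
plus Möbius invariance (translation and scaling are lattice-exact in the limit; inversion is the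
content; card sl2-from-arm-decay derives the infinitesimal sl₂ identities from the Ward kernel + s⁻⁴
arm decay). [difficulty: open-problem] [Smirnov2001, Werner2007, Cardy1992]
#9 HullCovariance (support; milestone) — one continuous f on (0,1) such that for every fat
rectilinear hull L, its hydrodynamic uniformizer ψ and image marks y₀<y₁<y₂<y₃, P_δ(ℍ∖L; ψ[y₀,y₁],
ψ[y₂,y₃]) → f(crossRatio y): CI + existence for hull complements with transported arcs; L = ∅ is
HalfPlaneMobius; Monte-Carlo-testable on box hulls (Schwarz–Christoffel cross-ratios). [deps:
FaceWard, HalfPlaneMobius] [difficulty: open-problem] [Smirnov2001, Lawler2005, BollobasRiordan2006]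
#9 HydroUniformizer (support; classical input) — for every fat rectilinear hull L: a conformal ψ : ℍ
→ ℍ∖L with ψ(w) − w → 0 at ∞ exists (Riemann mapping + Schwarz reflection, Lawler2005 Prop 3.36, p.
69), its boundary extension is continuous on the closed half-plane (∂(ℍ∖L) is a finite union of
segments: Carathéodory–Torhorst, Pommerenke1992 Thm 2.1, p. 20), and any two such ψ agree on ℍ
(uniqueness, ibid.). Known; the work is formalisation (no Riemann mapping theorem in Mathlib).
[difficulty: L] [Lawler2005, Pommerenke1992, Ahlfors1979]
#9 WardIntegration (support; GLUE) — HydroUniformizer → FaceWard → HalfPlaneMobius → HullCovariance: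
slab schedule ∅ = L₀, …, L_N = L inside one frame (schedule lemma: refine L by the grid of its
corner coordinates, add cells outward from the ground keeping every prefix grounded and pocket-free;
FaceWard is symmetric, so slabs may also be removed), y fixed, arcs transported by the ψ_k (ψ₀ = id
by uniqueness, ψ_N = the given ψ), N·ηε summed for δ < min_k δ₀(k), then η → 0; bookkeeping, no
percolation estimate. [difficulty: M] [Lawler2005, FriedrichWerner2003]
#9 JordanBridge (support; GLUE into the target) — HydroUniformizer → HullCovariance →
FlatMarkedCovariance: sandwich the G02 crossing event of a flat-marked Jordan R between crude
crossing events of two rectilinear hull complements (free arcs pushed out / marked arcs pushed in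
for the upper bound, conversely for the lower, by path surgery — no duality needed; the four flat
marks shared, junction errors = boundary arm events in half-discs, RSW; bounded ↔ unbounded by a
thin tube from the top free arc to the outside of a box, cost e^{−c/w}), limits f(η±_n) from
HullCovariance, η±_n → crossRatio x by Carathéodory kernel convergence with uniformly locally
connected boundaries (Pommerenke1992 Thm 1.8, Cor 2.4), f continuous. (why it might fail: only
through a G02 `discreteCrossing` pathology for a wild flat-marked Jordan boundary away from the
marks — the residual risk the target and TubeReduction already carry; degenerate arcs are excluded
by the NegDegenerateArcs refutation, stmt-0748.) [difficulty: L] [Pommerenke1992,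
BollobasRiordan2006, Grimmett1999, CamiaNewman2007, Kesten1982]
#6′ WardIntegration2 (record only — filed 2026-08-16T03:2xZ as stmt-CriticalPhenomena-14571 by the
PARALLEL badge-repair unit rbadge-CriticalPhenomena-CardyCapacity-d86eefba for the same A11 hold,
and closed `moot` / dropped from the route at 03:59Z once the chain above had landed) —
BoundaryWardIdentity → CapacityCharge → HalfPlaneMobius → FlatMarkedCovariance, the COARSE one-step
statement of the same second layer. Recorded so that it is not re-filed as independent glue: its
honest proof is exactly (r2, r3 ⊢ FaceWard by MicroFactorisation, the unfiled PointToFace step) +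
HydroUniformizer + WardIntegration + JordanBridge, and the caveat below (point identities at flat
points do not integrate by themselves) is why it cannot be proved more cheaply.
[BollobasRiordan2006, GarbanPeteSchramm2013]

TWO-LAYER PLAN. FILED 2026-08-16 (operator route-choice on target-unreachable, option (a) "add glue
items Crux… → FlatMarkedCovariance"; the parallel badge-repair unit briefly filed the coarse edge
WardIntegration2 = r2 → r3 → HalfPlaneMobius → target, since dropped as moot, see #6′ above):
FlatMarkedCovariance ⇐ JordanBridge(HydroUniformizer, HullCovariance), HullCovariance ⇐
WardIntegration(HydroUniformizer, FaceWard,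
HalfPlaneMobius) — all filed as top-level items (no `--split`, so the two-layer budget is untouched:
12 items; cruxes r2 r3 r4 r5 r6 + HalfPlaneMobius re-badged crux by the badge unit + the target
auto-cruxed by the gate as a closes hypothesis). Design
notes: (i) the foreseen MicroFactorisation (cell-pivotal / hull-pivotal ratio limits,
GarbanPeteSchramm2013 §§3-5 technology,
calibrated by the exact row-translation invariance of ℤ×ℕ) is NOT an item — it is the intended proof
route of FaceWard from
BoundaryWardIdentity and rides as `--supports FaceWard` lemmas; (ii) the foreseen
RectilinearIntegration is split into the
bookkeeping WardIntegration and the discretisation/Jordan bridge JordanBridge, with the classical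
complex analysis isolated in
HydroUniformizer; (iii) marked arcs are transported boundary images, not real segments, because
hydrodynamic transport of REAL
marks along a hull-growth path swallows them (x(t) = √(y² − 4t) for the growing slit) and because
the target admits dented
marked arcs, which the real-segment functional of r2/r3 cannot express. Second foreseen split
(unchanged, not filed):
BoundaryWardIdentity ⇐ CapacityCharge → HydrodynamicKernel (positional law at L = ∅: response
density ∝ Σ_j m_j/(x_j−z),
m_j the mark 2-arm densities) → CovariantTransport (L ≠ ∅ via g_L) → BoundaryWardIdentity.
Small-hull identities at
flat points do NOT integrate by themselves (flatness at scale ≫ ε is destroyed by the previous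
removal) — which is why the
glue runs through FaceWard and nobody files "BoundaryWardIdentity → FlatMarkedCovariance".

KILL CRITERIA. ¬CapacityCharge (a fat hull pair with response ratio ≠ hcap ratio, rigorously or by a
clean Monte-Carlo at several
scales) refutes BoundaryWardIdentity, FlatMarkedCovariance and — since CI implies all of them —
signals ¬CardyFormulaZ2:
close `refuted:CapacityCharge` and hand the witness to the negatives index (it would kill every
Cardy route). ¬TubeReduction
can only come from a discretisation pathology of G02's `discreteCrossing` for wild Jordan
boundaries: report to the
operator (statement hygiene), pivot the assembly to an admissible-rectangle version
(CardyViaSLE6.AdmissibleSuffices).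
¬CardyRigidity is impossible without a conformally invariant non-Cardy limit (refutes the conjunct).
X_U proved by any
sibling route moots FlatMarkedCovariance/TubeReduction but not r2/r3 (they remain the local content
and a test).

NOT DECOMPOSED YET. The positional (Cauchy-kernel) law and the microscopic factorisation as separate
items (they are FaceWard's
proof route, attached with --supports); the reflex-corner wedge exponent (> 1 for three alternating
arms in a 270° wedge —
conjecturally 4/3, no RSW proof known) inside FaceWard; the order of limits δ → 0 then ε → 0 versus
joint regimes δ ≪ ε
(FaceWard keeps δ₀ per configuration and only ε₀ uniform over the frame); the schedule lemma of
WardIntegration (every fat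
rectilinear hull is reachable from ∅ by admissible slabs through fat hulls) as a named lemma;
Aut(ℍ)-rigidity and the
Riemann mapping theorem behind HydroUniformizer (Literature-grade formalisation blockers shared with
TubeReduction and
CardyRigidity); the value f = F (entirely delegated to CardyRigidity; cards
null-vector-three-arm-fusion-law /
pure-product-boundary-pivotal are alternative value engines on the half-plane and could later
replace r5 on the flat-marked
class); a rank for HalfPlaneMobius (crux at rank 9) and whether HydroUniformizer should be badged
crux so that the gate counts the target as derived rather than auto-crux (tenure).

CHEAPEST FALSIFIER. Monte-Carlo on the ℤ×ℕ half-plane at p = 1/2 (kit job, not yet run: hub is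
compute-free and this seat is one-shot):
estimate Resp(z+εK) = P(cross) − P(cross with hull removed) for K = unit half-disc versus K' = unit
half-square
[−1/2,1/2]×[0,1] (hcap ratio computable to any precision from the Schwarz–Christoffel map, an
elliptic integral) and versus
the 2×(1/2) flat box, at ε/δ = 8, 16, 32, 64 with marks at distance ≈ 20ε; CI predicts the response
ratios converge to the hcap
ratios with corrections O(δ/ε). A ratio stabilising elsewhere kills CapacityCharge and with it
conformal invariance of
bond-ℤ² crossings. Second cheap check (lookup, done): FriedrichWerner2003 Prop. 1 confirms the
continuum side (slit of
capacity ε², kernel 1/(z−x)+1/x) so the conformal bookkeeping of r2 is the standard one.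

NUMBERS. hcap(closed unit half-disc) = 1, hcap(vertical unit slit) = 1/2, hcap(A) ≤ rad(A)²
(Lawler2005 (3.9); tree hcap_le with
constant 288); half-plane 2-arm exponent 1 and 3-arm exponent 2 on ℤ² (SmirnovWernerMRL2001 §4,
Nolin2008 Thm 23/24,
LawlerSchrammWernerEJP2002 App. A; tree facts for 𝕋: Nolin2008_halfPlane_twoArm,
LawlerSchrammWerner2002_halfPlane_threeArm);
first-order Loewner map of a boundary bump of height h: g(w) = w + (1/π)∫h(t)dt/(w−t) + O(h²). Items
at open: 7; 12 after the 2026-08-16 repairs (route-choice: +FaceWard, HullCovariance,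
HydroUniformizer, WardIntegration, JordanBridge; badge repair: HalfPlaneMobius → crux,
WardIntegration2 filed and dropped).

DEFINITION REQUESTS. None: embDomainCrossing, bondPercolation, ConformalEquiv(.HasBoundaryValue),
ConformalRectangle.HasCrossingLimit exist and are
imported (Percolation.CardyFormula cone); IsBoundedHull / IsHydrodynamicMap / hcap exist in the tree
(RestrictionHulls, HydrodynamicMaps) but are
INLINED in r2/r3 (cone repair 2026-08-15: their files import RestrictionMeasures/CritPercSLE, whose
unproved facts no item uses); a prover
rewrites them back by Iff.rfl (and `HasHcap ↔ IsHydrodynamicMap ∧ c = hcap`,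
IsHydrodynamicMap.tendsto_mul_sub_self). NEEDS-FACT: none —
no Literature named fact is a hypothesis of any item; the unproved facts still in the FILE-level
import closure arrive through
Summits.CriticalPhenomena.Statement / CardyFormulaZ2 Statement.lean (SelfAvoidingWalk,
CriticalContinuity, ScalingLimit3D, SLE, Isoradial,
CardyUniversality) and are operator hygiene, not route content. Foreseen (layer 2): a Literature
notion of boundary k-arm events for
bond-ℤ² in a domain (the 𝕋 file HalfPlaneArmEvents.lean has domArmEvent for site-𝕋 only) and the
named facts "hp 2-arm = 1,
hp 3-arm = 2 on bond-ℤ²".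

Novelty: Searches (2026-08-15): `lit search --hybrid "boundary Ward identity stress tensor percolation
crossing probability
half-plane capacity"` (8 book hits: Lawler2005, Kesten1982, BollobasRiordan2006, DiFrancesco CFT —
none lattice-side);
`lit search --source arxiv|s2|openalex` (HTTP 429, rate-limited), `--source zbmath "percolation
crossing probability stress
tensor Ward"` (0); `lit galaxy search "Ward identity percolation lattice stress tensor" --star all
--mode substring` (0 rows,
crabby down); `lit frontier CriticalPhenomena --since 2021` (30 rows; nearest arXiv:2603.28161
boundary four-point CLE
connectivities, continuum); `lit bridges CriticalPhenomena --cross any` (arXiv:1910.05796 Peltola,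
CFT/Ward survey for SLE);
`lit read arxiv:math-ph/0301018` p. 6 Prop. 1 and `lit read arxiv:1008.1378` p. 10 (read). Plus the
refuter novelty audit of
the card (2026-08-15T05:24Z).
Nearest prior art found: FriedrichWerner2003 (arXiv:math-ph/0301018) Prop. 1 — the boundary Ward
identity of restriction
measures obtained by removing a slit of capacity ε² and normalising by ε⁻², kernel
(1/(x_j−x)+1/x)∂_j − 2h/(x_j−x)²;
arXiv:math-ph/0511054 (Doyon–Riva–Cardy) and arXiv:1209.1560 (Doyon): stress tensor of CLE as the
rescaled small-deformation
response, Ward identities FROM conformal invariance; GarbanPeteSchramm2013 (arXiv:1008.1378):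
pivotal measures, ratio limits
and conformal covariance on 𝕋, coupling technology valid on ℤ² along subsequences (p. 10).
Delta: the lattice converse on bond-ℤ²  [refs: 2603.28161, 1910.05796, math-ph/0301018, 1008.1378, math-ph/0511054, 1209.1560, arxiv:math-ph/0301018, arxiv:1008.1378, Lawler2005, Kesten1982, BollobasRiordan2006, FriedrichWerner2003, GarbanPeteSchramm2013]

Barriers (technique_class: hadamard-variation boundary-stress-tensor arm-response): - technique_class: hadamard-variation boundary-stress-tensor arm-response
- Literature.Barriers.CriticalPhenomena.EmbeddingModulusUniqueness: applies and is respected —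
BoundaryWardIdentity/CapacityCharge are embedding-specific (for the sheared lattice the response is
proportional to the capacity of the SHEARED hull), so any proof must use the square embedding (the
x↔y reflection and π/2 rotation of ℤ² enter through the four orientations τ⁴ = 1 and through the
reflex/convex corner analysis); no embedding-blind argument is claimed (evasion (i) of the
catalogue).
- Literature.Barriers.CriticalPhenomena.CoveringLatticeShift: shares only the Russo-formula token —
here Russo varies the DOMAIN at the fixed self-dual p = 1/2, no measure-changing shift q ↦ 1−q
occurs; Beffara's diagnosis "what is missing is how P[v pivotal] depends on the marks" is exactly
what r2 asserts (dependence = hydrodynamic kernel).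
- Literature.Barriers.CriticalPhenomena.SmirnovTriangularOnly: not in class — no three-colour
observable, no colour switching, no 2π/3 symmetry is used.
- Literature.Barriers.CriticalPhenomena.FKParafermionicHalfCauchyRiemann: not in class — no linear
vertex relations for an observable; the only "holomorphic" object is the continuum hydrodynamic map.
- Negatives index: one refuted statement for the summit (stmt-CriticalPhenomena-0772, SAW
parafermion tightness), unrelated to percolation crossings; nothing here restates it.

History (route lifecycle, newest last):
- 2026-08-15T16:54:20Z · rev 3: restated BoundaryWardIdentity (stmt-CriticalPhenomena-4620), CapacityCharge (stmt-CriticalPhenomena-4621) — route-repair (cone guardrail gen 2, unit rrepair-CriticalPhenomena-CardyCapacit-d86eefba-g2): RE-ROUTED AROUND the 4 listed facts. imports := [Literature.Probab (planner-rrepair-CriticalPhenomena-CardyCapacit-d86eefba-g2-0)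
- 2026-08-16T03:59:09Z · AUTO-CRUX (edit): FlatMarkedCovariance — hypotheses of the deciding theorem that nothing in the route derives are cruxes (planner-rchoice-CriticalPhenomena-CardyCapacit-befcc79e-0)
- 2026-08-24T07:57:07Z · DORMANT — reconciler: no traction for 6.6 d (last activity item-evidence-added at 2026-08-17T16:53:14Z); parked, not closed — `ledger route dormant route-CriticalPhenomen (operator:999:2519776)

sub-problem: CardyFormulaZ2 · status: dormant · opened planner-plancard-CriticalPhenomena-CardyFormu-d677d41d-0 2026-08-15T11:34:40Z · rev 17 · ledger route-CriticalPhenomena-CardyCapacityWard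
GENERATED by the gate from the ledger (D-0016/17). Provers cite these decls: `theorem foo : Summit.CriticalPhenomena.CardyFormulaZ2.Theses.CardyCapacityWard.<Decl> := …` in Summits/CriticalPhenomena/CardyFormulaZ2/Theorems/<Name>.lean.
-/

namespace Summit.CriticalPhenomena.CardyFormulaZ2.Theses.CardyCapacityWard

open scoped BigOperators Topology Manifold Classical MeasureTheory ProbabilityTheory Matrix InnerProductSpace ComplexConjugate ContinuousMap
open Filter Set Function TopologicalSpace MeasureTheory

attribute [summit_statement] _root_.CardyFormulaZ2

/-- item stmt-CriticalPhenomena-4619 · crux (kind.auto-crux: conjecture-grade) · rank 0 · open · by planner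
why it might fail: CI + existence of the limit for the flat-marked subclass (open: BollobasRiordan2006 Ch7 Conj 1, Λ = bond ℤ²): fails iff ℤ² crossing limits are non-unique or only shear- /similarity-covariant (Beffara2008Universal Prop 4); as typed it inherits any G02-discretisation pathology of CardyFormulaZ2 itself.
sources: Smirnov2001, Beffara2008Universal, BollobasRiordan2006, Schramm2000
[target] one continuous f on (0,1) gives the δ → 0⁺ limit f(η) of bond-ℤ² crossing probabilities for
every conformal rectangle contained in ℍ with an upper half-ball around each mark inside the domain
(flat-marked rectangles). -/
@[route_item "route-CriticalPhenomena-CardyCapacityWard", crux]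
def FlatMarkedCovariance : Prop :=
  ∃ f : ℝ → ℝ, ContinuousOn f (Set.Ioo 0 1) ∧ ∀ R : Literature.Probability.RandomPlanarGeometry.ConformalRectangle, R.carrier ⊆ UpperHalfPlane.upperHalfPlaneSet → (∀ i, ∃ ρ > 0, Metric.ball (R.pt i) ρ ∩ UpperHalfPlane.upperHalfPlaneSet ⊆ R.carrier) → R.HasCrossingLimit (Literature.Probability.Percolation.bondDomainCrossingProb R) f

-- earlier BoundaryWardIdentity (stmt-CriticalPhenomena-4620, replaced 2026-08-15T16:54:20Z -> stmt-CriticalPhenomena-11205): retired by None — let P : Set ℂ → ℝ → (Fin 4 → ℝ) → ℝ := fun K δ x ↦ (Literature.Probability.Percolation.bondPercolation (Literature.Probability.LatticeModels.zdGraph 2) Literature.Probability.Percolation.half).real (Literature.Probability.Percolation.embDomainCrossing Literat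
/-- item stmt-CriticalPhenomena-11205 · crux · rank 2 · open · by planner
why it might fail: CI in the small on bond-ℤ²: false iff the boundary 3-arm response is not hcap-covariant (a sheared embedding answers to the capacity of the SHEARED hull: Beffara2008Universal Prop 4) or carries an L- or τ-dependent normalisation; both sides are Θ(ε²) only as the hp exponents are exactly 2 and 1.
sources: FriedrichWerner2003, DoyonRivaCardy2006, Doyon2013CLEStressTensor, Lawler2005, GarbanPeteSchramm2013, Beffara2008Universal
[crux] (card items (2)+(4), covariant and derivative-free; cone repair 2026-08-15: `IsBoundedHull`
and `IsHydrodynamicMap` INLINED verbatim as local lets IsHull / IsHydro, and z now ρ-far from the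
closed marked ARCS per refuter rreview f884a1c3) on the lattice half-plane with a fat bounded hull L
removed (crude discretisation embDomainCrossing of ℍ∖L, marks x real, marked arcs [x₀,x₁],[x₂,x₃]
off L), let z be a boundary point of ℍ∖L flat at scale ρ in one of the four axis orientations τ
(τ⁴=1), at distance ≥ ρ from both closed marked arcs, and K ⊆ B̄(0,1) a fat hull shape. Then for ε
small, removing z+ετK changes the crossing probability, up to η·ε², exactly as replacing the marks x
by x' := g_L⁻¹(g_{L∪(z+ετK)}(x)) (conformal maps ℍ∖hull → ℍ with φ(w) − w → 0 at ∞, and their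
boundary values y = g_{L∪(z+ετK)}(x) = g_L(x')) does: |P_δ(ℍ∖(L∪(z+ετK)); x) − P_δ(ℍ∖L; x')| ≤ ηε²
for all small δ. At L = ∅, τ = 1 this is the flat boundary Ward identity "3-arm response =
hcap(K)·Σ_j(2-arm density)_j/(x_j−z)" without derivatives. [deps: CapacityCharge] [difficulty:
open-problem] -/
@[route_item "route-CriticalPhenomena-CardyCapacityWard"]
def BoundaryWardIdentity : Prop :=
  let P : Set ℂ → ℝ → (Fin 4 → ℝ) → ℝ := fun K δ x ↦ (Literature.Probability.Percolation.bondPercolation (Literature.Probability.LatticeModels.zdGraph 2) Literature.Probability.Percolation.half).real (Literature.Probability.Percolation.embDomainCrossing Literature.Probability.LatticeModels.Site.toComplex (UpperHalfPlane.upperHalfPlaneSet \ K) δ (Complex.ofReal '' Set.Icc (x 0) (x 1)) (Complex.ofReal '' Set.Icc (x 2) (x 3))); let IsHull : Set ℂ → Prop := fun A ↦ Bornology.IsBounded A ∧ closure (A ∩ UpperHalfPlane.upperHalfPlaneSet) = A ∧ IsSimplyConnected (UpperHalfPlane.upperHalfPlaneSet \ A); let IsHydro : (A : Set ℂ) → Literature.Probability.RandomPlanarGeometry.ConformalEquiv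 (UpperHalfPlane.upperHalfPlaneSet \ A) UpperHalfPlane.upperHalfPlaneSet → Prop := fun A φ ↦ Filter.Tendsto (fun w ↦ φ w - w) (Filter.cocompact ℂ ⊓ Filter.principal (UpperHalfPlane.upperHalfPlaneSet \ A)) (nhds 0); ∀ (L K : Set ℂ) (τ z : ℂ) (ρ : ℝ) (x : Fin 4 → ℝ), IsHull L → IsHull K → closure (interior L) = L → closure (interior K) = K → K ⊆ Metric.closedBall 0 1 → τ ^ 4 = 1 → 0 < ρ → StrictMono x → (∀ t : ℝ, (t : ℂ) ∈ L → t ∉ Set.Icc (x 0) (x 1) ∧ t ∉ Set.Icc (x 2) (x 3)) → (∀ t : ℝ, t ∈ Set.Icc (x 0) (x 1) ∪ Set.Icc (x 2) (x 3) → ρ ≤ dist (t : ℂ) z) → Metric.ball z ρ ∩ (UpperHalfPlane.upperHalfPlaneSet \ L) = Metric.ball z ρ ∩ {w | 0 < ((w - z) / τ).im} → ∀ η : ℝ, 0 < η → ∃ ε₀ : ℝ, 0 < ε₀ ∧ ∀ ε : ℝ, ε ∈ Set.Ioo 0 ε₀ → ∀ (φ₁ : Literature.Probability.RandomPlanarGeometry.ConformalEquiv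 (UpperHalfPlane.upperHalfPlaneSet \ L) UpperHalfPlane.upperHalfPlaneSet) (φ₂ : Literature.Probability.RandomPlanarGeometry.ConformalEquiv (UpperHalfPlane.upperHalfPlaneSet \ (L ∪ (fun w ↦ z + (ε : ℂ) * τ * w) '' K)) UpperHalfPlane.upperHalfPlaneSet) (x' y : Fin 4 → ℝ), IsHydro L φ₁ → IsHydro (L ∪ (fun w ↦ z + (ε : ℂ) * τ * w) '' K) φ₂ → (∀ i, φ₂.HasBoundaryValue ((x i : ℝ) : ℂ) ((y i : ℝ) : ℂ)) → StrictMono x' → (∀ t : ℝ, (t : ℂ) ∈ L → t ∉ Set.Icc (x' 0) (x' 1) ∧ t ∉ Set.Icc (x' 2) (x' 3)) → (∀ i, φ₁.HasBoundaryValue ((x' i : ℝ) : ℂ) ((y i : ℝ) : ℂ)) → ∃ δ₀ : ℝ, 0 < δ₀ ∧ ∀ δ : ℝ, δ ∈ Set.Ioo 0 δ₀ → |P (L ∪ (fun w ↦ z + (ε : ℂ) * τ * w) '' K) δ x - P L δ x'| ≤ η * ε ^ 2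

-- earlier CapacityCharge (stmt-CriticalPhenomena-4621, replaced 2026-08-15T16:54:20Z -> stmt-CriticalPhenomena-11246): retired by None — let P : Set ℂ → ℝ → (Fin 4 → ℝ) → ℝ := fun K δ x ↦ (Literature.Probability.Percolation.bondPercolation (Literature.Probability.LatticeModels.zdGraph 2) Literature.Probability.Percolation.half).real (Literature.Probability.Percolation.embDomainCrossing Literature.Pr
/-- item stmt-CriticalPhenomena-11246 · crux · rank 3 · open · by planner
why it might fail: Holds iff K ↦ lim ε⁻²Resp(z+εK) is ∝ hcap K: a merely shear-covariant ℤ² limit (Beffara2008Universal Prop 4) gives the capacity of a sheared hull; a response not factoring through a 3-arm density lets the ratio remember K beyond hcap; MC falsifier (half-disc vs half-square, ε/δ = 8..64) not yet run.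
sources: FriedrichWerner2003, Lawler2005, GarbanPeteSchramm2013, arXiv:0903.4496, SmirnovWernerMRL2001, Nolin2008
[crux] (card crux (2), mark-free capacity sum rule; cone repair 2026-08-15: `IsBoundedHull` INLINED
verbatim as IsHull and `hcap K φ` written as the explicit limit c of w(φ(w) − w) at ∞ in ℍ∖K for a
conformal φ : ℍ∖K → ℍ (Lawler2005 Def 3.37) — HasHcap K φ c ↔ IsHydrodynamicMap K φ ∧ c = hcap K φ
for K ⊆ B̄(0,1), planner file Faithful.lean) on the flat lattice half-plane with real marks x and a
free real boundary point z off the closed marked arcs, for fat hull shapes K, K' ⊆ B̄(0,1) with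
half-plane capacities c, c' the pivotal responses Resp(H) := P_δ(ℍ; x) − P_δ(ℍ∖H; x) satisfy
|Resp(z+εK)·c' − Resp(z+εK')·c| ≤ ηε² (δ → 0 first, then ε small): the boundary 3-arm response
functional is proportional to half-plane capacity (unit half-disc : K = 1 : hcap K). Necessary for
BoundaryWardIdentity (take L = ∅ and RSW-Lipschitz continuity in the marks); the cheapest decisive
test of CI on ℤ². [difficulty: XL] -/
@[route_item "route-CriticalPhenomena-CardyCapacityWard"]
def CapacityCharge : Prop :=
  let P : Set ℂ → ℝ → (Fin 4 → ℝ) → ℝ := fun K δ x ↦ (Literature.Probability.Percolation.bondPercolation (Literature.Probability.LatticeModels.zdGraph 2) Literature.Probability.Percolation.half).real (Literature.Probability.Percolation.embDomainCrossing Literature.Probability.LatticeModels.Site.toComplex (UpperHalfPlane.upperHalfPlaneSet \ K) δ (Complex.ofReal '' Set.Icc (x 0) (x 1)) (Complex.ofReal '' Set.Icc (x 2) (x 3))); let IsHull : Set ℂ → Prop := fun A ↦ Bornology.IsBounded A ∧ closure (A ∩ UpperHalfPlane.upperHalfPlaneSet) = A ∧ IsSimplyConnected (UpperHalfPlane.upperHalfPlaneSet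 \ A); let HasHcap : (A : Set ℂ) → Literature.Probability.RandomPlanarGeometry.ConformalEquiv (UpperHalfPlane.upperHalfPlaneSet \ A) UpperHalfPlane.upperHalfPlaneSet → ℝ → Prop := fun A φ c ↦ Filter.Tendsto (fun w ↦ w * (φ w - w)) (Filter.cocompact ℂ ⊓ Filter.principal (UpperHalfPlane.upperHalfPlaneSet \ A)) (nhds (c : ℂ)); ∀ (K K' : Set ℂ) (φ : Literature.Probability.RandomPlanarGeometry.ConformalEquiv (UpperHalfPlane.upperHalfPlaneSet \ K) UpperHalfPlane.upperHalfPlaneSet) (φ' : Literature.Probability.RandomPlanarGeometry.ConformalEquiv (UpperHalfPlane.upperHalfPlaneSet \ K') UpperHalfPlane.upperHalfPlaneSet) (c c' : ℝ), IsHull K → IsHull K' → closure (interior K) = K → closure (interior K') = K' → K ⊆ Metric.closedBall 0 1 → K' ⊆ Metric.closedBall 0 1 → HasHcap K φ c → HasHcap K' φ' c' → ∀ (x : Fin 4 → ℝ) (z : ℝ), StrictMono x → z ∉ Set.Icc (x 0) (x 1) → z ∉ Set.Icc (x 2) (x 3) → ∀ η : ℝ, 0 < η → ∃ ε₀ : ℝ,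 0 < ε₀ ∧ ∀ ε : ℝ, ε ∈ Set.Ioo 0 ε₀ → ∃ δ₀ : ℝ, 0 < δ₀ ∧ ∀ δ : ℝ, δ ∈ Set.Ioo 0 δ₀ → |(P ∅ δ x - P ((fun w ↦ (z : ℂ) + (ε : ℂ) * w) '' K) δ x) * c' - (P ∅ δ x - P ((fun w ↦ (z : ℂ) + (ε : ℂ) * w) '' K') δ x) * c| ≤ η * ε ^ 2

/-- item stmt-CriticalPhenomena-4622 · crux · rank 4 · open · by planner
why it might fail: X_U covers ALL Jordan rectangles (G02): an R with no dihedral image in open ℍ is reached only via δℤ²-translates, so sub-mesh translation robustness of discreteCrossing (largest component, closest-arc) for wild boundaries is needed (unwritten); false iff a wild-at-a-mark R breaks HasCrossingLimit.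
sources: CamiaNewman2007, BollobasRiordan2006, Pommerenke1992, KemppainenSmirnov2017, Nolin2008, lean:Literature.Probability.LatticeModels.discreteArc
[crux] flat-marked covariance implies X_U for ALL conformal rectangles with the same f: hang from
each mark of R a thin vertical tube down to a common baseline below R (width w ≫ δ), put the new
marks at the tube bottoms; RSW one-arm bounds at the marks make the crossing probabilities of R and
of the tubed domain differ by o_w(1) uniformly in δ ≤ δ(w), Radó/Carathéodory continuity makes the
cross-ratios differ by o_w(1), and f is continuous. [deps: FlatMarkedCovariance] [difficulty: L] -/
@[route_item "route-CriticalPhenomena-CardyCapacityWard", crux]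
def TubeReduction : Prop :=
  FlatMarkedCovariance → ∃ f : ℝ → ℝ, ∀ R : Literature.Probability.RandomPlanarGeometry.ConformalRectangle, R.HasCrossingLimit (Literature.Probability.Percolation.bondDomainCrossingProb R) f

/-- item stmt-CriticalPhenomena-0746 · crux · rank 5 · open · by planner
why it might fail: Fails only if bond-ℤ² had a conformally invariant crossing limit f ≠ F. As a THEOREM nothing in print runs the SLE₆ identification with an UNKNOWN kernel on fixed Jordan rectangles: CN2007 Thms 2–3 pp486–9 use moving admissible domains + explicit F (Werner2007 §3.8 explicit Ψ); κ=6 rebuilt from f.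
sources: doi:10.1007/s00440-006-0049-7, arXiv:math/9904022, arXiv:math/9911084, arXiv:0710.0856, Lawler2005, arXiv:1212.6215
[crux] Cardy rigidity on Z^2: if the bond-Z^2 crossing probabilities of ALL conformal rectangles
converge to a function f of the cross-ratio, then f = cardyFunction on (0,1). Intended proof: with f
as hitting kernel, Smirnov2001 Thm 2 / CamiaNewman2007 §§5-7 / Werner2007 §4 give convergence of the
exploration path (AB tightness isTightLaws_map_bondInterface, RSW rsw_half) to a conformally
invariant domain-Markov curve = SLE_κ (Schramm2000); percolation locality forces κ = 6
(LawlerSchrammWerner2001 §3, cf. eq_six_of_forall_measureReal_hitsBefore) and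
sle_six_measureReal_hitsBefore returns f = F. Vacuous unless X_U holds, but provable
unconditionally. -/
@[route_item "route-CriticalPhenomena-CardyCapacityWard", crux]
def CardyRigidity : Prop :=
  ∀ f : ℝ → ℝ, (∀ R : Literature.Probability.RandomPlanarGeometry.ConformalRectangle, R.HasCrossingLimit (Literature.Probability.Percolation.bondDomainCrossingProb R) f) → Set.EqOn f Literature.Probability.RandomPlanarGeometry.cardyFunction (Set.Ioo 0 1)

/-- item stmt-CriticalPhenomena-14539 · crux · rank 6 · open · by planner
why it might fail: CI in the small, integrated: false iff bond-ℤ² face responses are not hydrodynamic/hcap-covariant (a sheared embedding is not: Beffara2008Universal Prop 4); o(ε) at reflex corners needs the 3π/2-wedge 3-arm exponent > 1 (conj. 4/3, no ℤ² proof); arcs on the pushed face included.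
sources: FriedrichWerner2003, Lawler2005, GarbanPeteSchramm2013, Beffara2008Universal, SmirnovWernerMRL2001, Nolin2008
[crux] Face/slab Ward identity — the integrated form of BoundaryWardIdentity, foreseen as FaceWard
in the two-layer plan and filed 2026-08-16 as the load-bearing premise of the glue chain to the
target (ranked 6 only because 2–5 were taken). Frame: m boxes, size R, minimal face length ℓ₀, image
marks y₀<y₁<y₂<y₃, tolerance η; then ∃ ε₀ such that for every fat rectilinear hull L₁ (≤ m closed
axis-parallel boxes, bounded, closure(L₁∩ℍ) = L₁, ℍ∖L₁ simply connected, closure(interior L₁) = L₁)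
and every slab S = z + τ([0,ℓ]×[0,ε]) (τ⁴ = 1, ℓ ≥ ℓ₀, ε < ε₀) whose base z + τ[0,ℓ] lies on ∂(ℍ∖L₁)
(inside L₁ or on ℝ) and whose open part lies in ℍ∖L₁, with L₂ = L₁ ∪ S again a fat hull inside
[−R,R]×[0,R]: for the hydrodynamic uniformizers ψ_i : ℍ → ℍ∖L_i (ψ_i(w) − w → 0 at ∞, i.e. ψ_i =
g_{L_i}⁻¹, Lawler2005 Prop 3.36 p. 69) and the TRANSPORTED marked arcs A_i = ψ_i[y₀,y₁], B_i =
ψ_i[y₂,y₃] (images under the boundary extension), |P_δ(ℍ∖L₂; A₂, B₂) − P_δ(ℍ∖L₁; A₁, B₁)| ≤ ηε for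
all δ < δ₀(configuration), P_δ the crude bond-ℤ² crossing probability (embDomainCrossing, as in
r2/r3). In words: pushing a flat face or sub-face by ε (or seeding a slab on ℝ) changes the crossing
probability exactly as -/
@[route_item "route-CriticalPhenomena-CardyCapacityWard"]
def FaceWard : Prop :=
  let P : Set ℂ → ℝ → Set ℂ → Set ℂ → ℝ := fun L δ A B ↦ (Literature.Probability.Percolation.bondPercolation (Literature.Probability.LatticeModels.zdGraph 2) Literature.Probability.Percolation.half).real (Literature.Probability.Percolation.embDomainCrossing Literature.Probability.LatticeModels.Site.toComplex (UpperHalfPlane.upperHalfPlaneSet \ L) δ A B); let IsHull : Set ℂ → Prop := fun A ↦ Bornology.IsBounded A ∧ closure (A ∩ UpperHalfPlane.upperHalfPlaneSet) = A ∧ IsSimplyConnected (UpperHalfPlane.upperHalfPlaneSet \ A); let IsRect : ℕ → Set ℂ → Prop := fun m A ↦ ∃ a b c d : Fin m → ℝ, A = ⋃ i, Complex.reProdIm (Set.Icc (a i) (b i)) (Set.Icc (c i) (d i)); let IsHydro : (ℂ → ℂ) → Prop := fun g ↦ Filter.Tendsto (fun w ↦ g w - w) (Filter.cocompact ℂ ⊓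 Filter.principal UpperHalfPlane.upperHalfPlaneSet) (nhds 0); let Arc : (ℂ → ℂ) → ℝ → ℝ → Set ℂ := fun γ a b ↦ γ '' (Complex.ofReal '' Set.Icc a b); let Slab : ℂ → ℂ → ℝ → ℝ → Set ℂ := fun z τ ℓ ε ↦ (fun w ↦ z + τ * w) '' Complex.reProdIm (Set.Icc 0 ℓ) (Set.Icc 0 ε); ∀ (m : ℕ) (R ℓ₀ : ℝ) (y : Fin 4 → ℝ) (η : ℝ), 0 < ℓ₀ → StrictMono y → 0 < η → ∃ ε₀ : ℝ, 0 < ε₀ ∧ ∀ (L₁ : Set ℂ) (z τ : ℂ) (ℓ ε : ℝ), IsHull L₁ → IsRect m L₁ → closure (interior L₁) = L₁ → τ ^ 4 = 1 → ℓ₀ ≤ ℓ → ε ∈ Set.Ioo 0 ε₀ → (fun w ↦ z + τ * w) '' Complex.reProdIm (Set.Icc 0 ℓ) {0} ⊆ L₁ ∪ {w | w.im = 0} → (fun w ↦ z + τ * w) '' Complex.reProdIm (Set.Ioo 0 ℓ) (Set.Ioc 0 ε) ⊆ UpperHalfPlane.upperHalfPlaneSet \ L₁ → IsHull (L₁ ∪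 Slab z τ ℓ ε) → closure (interior (L₁ ∪ Slab z τ ℓ ε)) = L₁ ∪ Slab z τ ℓ ε → L₁ ∪ Slab z τ ℓ ε ⊆ Complex.reProdIm (Set.Icc (-R) R) (Set.Icc 0 R) → ∀ (ψ₁ : Literature.Probability.RandomPlanarGeometry.ConformalEquiv UpperHalfPlane.upperHalfPlaneSet (UpperHalfPlane.upperHalfPlaneSet \ L₁)) (ψ₂ : Literature.Probability.RandomPlanarGeometry.ConformalEquiv UpperHalfPlane.upperHalfPlaneSet (UpperHalfPlane.upperHalfPlaneSet \ (L₁ ∪ Slab z τ ℓ ε))), IsHydro ψ₁ → IsHydro ψ₂ → ∃ δ₀ : ℝ, 0 < δ₀ ∧ ∀ δ : ℝ, δ ∈ Set.Ioo 0 δ₀ → |P (L₁ ∪ Slab z τ ℓ ε) δ (Arc ψ₂.boundaryExtension (y 0) (y 1)) (Arc ψ₂.boundaryExtension (y 2) (y 3)) - P L₁ δ (Arc ψ₁.boundaryExtension (y 0) (y 1)) (Arc ψ₁.boundaryExtension (y 2) (y 3))| ≤ η * ε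

/-- item stmt-CriticalPhenomena-4623 · crux · rank 9 · open · by planner
why it might fail: Open twice: existence of the δ→0 half-plane 4-point limit (only RSW cluster-point bounds, GrimmettPercolation1999 §11.10) and inversion invariance = CI content: an affine-covariant-only ℤ² limit (cf. Beffara2008Universal Prop 4) is f of two affine invariants, not of the cross-ratio.
sources: Smirnov2001, Werner2007, Cardy1992, GrimmettPercolation1999, BollobasRiordan2006, Beffara2008Universal
[support] the K = ∅ instance of the hull picture and the natural first milestone: half-plane
crossing probabilities of bond-ℤ² between [x₀,x₁] and [x₂,x₃] (crude discretisation) converge to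
f(crossRatio x) for one continuous f — existence of the half-plane limit plus Möbius invariance
(translation and scaling are lattice-exact in the limit; inversion is the content; card
sl2-from-arm-decay derives the infinitesimal sl₂ identities from the Ward kernel + s⁻⁴ arm decay).
[difficulty: open-problem] -/
@[route_item "route-CriticalPhenomena-CardyCapacityWard"]
def HalfPlaneMobius : Prop :=
  ∃ f : ℝ → ℝ, ContinuousOn f (Set.Ioo 0 1) ∧ ∀ x : Fin 4 → ℝ, StrictMono x → Filter.Tendsto (fun δ : ℝ ↦ (Literature.Probability.Percolation.bondPercolation (Literature.Probability.LatticeModels.zdGraph 2) Literature.Probability.Percolation.half).real (Literature.Probability.Percolation.embDomainCrossing Literature.Probability.LatticeModels.Site.toComplex UpperHalfPlane.upperHalfPlaneSet δ (Complex.ofReal '' Set.Icc (x 0) (x 1)) (Complex.ofReal '' Set.Icc (x 2) (x 3)))) (nhdsWithin 0 (Set.Ioi 0)) (nhds (f (Literature.Probability.RandomPlanarGeometry.crossRatio x)))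

/-- item stmt-CriticalPhenomena-14540 · support · rank 9 · open · by planner
why it might fail: It is conformal invariance + existence of the limit for hull complements: fails iff bond-ℤ² crossing limits are non-unique or only shear- /similarity-covariant (Beffara2008Universal Prop 4).
sources: Smirnov2001, Lawler2005, BollobasRiordan2006, Beffara2008Universal
[support] Hull covariance — the milestone the Ward calculus lands on: one f continuous on (0,1) such
that for every fat rectilinear hull L (≤ m boxes, any m; bounded, closure(L∩ℍ) = L, ℍ∖L simply
connected, closure(interior L) = L), its hydrodynamic uniformizer ψ : ℍ → ℍ∖L (ψ(w) − w → 0 at ∞)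
and image marks y₀<y₁<y₂<y₃, the crude bond-ℤ² crossing probability P_δ(ℍ∖L; ψ[y₀,y₁], ψ[y₂,y₃])
(arcs = boundary-extension images) tends to f(crossRatio y) as δ → 0⁺. This is CI + existence of the
limit for hull complements with transported arcs; L = ∅ (ψ = id) is HalfPlaneMobius. Reached from
FaceWard + HalfPlaneMobius by WardIntegration, feeds FlatMarkedCovariance through JordanBridge, and
is directly Monte-Carlo-testable (box hulls; cross-ratios from the Schwarz–Christoffel map). Why it
might fail: it is X_U for a concrete class — fails iff bond-ℤ² crossing limits are non-unique or not
Möbius/hcap-covariant (EmbeddingModulusUniqueness: no embedding-blind proof). [deps: FaceWard,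
HalfPlaneMobius, HydroUniformizer] [difficulty: open-problem] -/
@[route_item "route-CriticalPhenomena-CardyCapacityWard"]
def HullCovariance : Prop :=
  let P : Set ℂ → ℝ → Set ℂ → Set ℂ → ℝ := fun L δ A B ↦ (Literature.Probability.Percolation.bondPercolation (Literature.Probability.LatticeModels.zdGraph 2) Literature.Probability.Percolation.half).real (Literature.Probability.Percolation.embDomainCrossing Literature.Probability.LatticeModels.Site.toComplex (UpperHalfPlane.upperHalfPlaneSet \ L) δ A B); let IsHull : Set ℂ → Prop := fun A ↦ Bornology.IsBounded A ∧ closure (A ∩ UpperHalfPlane.upperHalfPlaneSet) = A ∧ IsSimplyConnected (UpperHalfPlane.upperHalfPlaneSet \ A); let IsRect : ℕ → Set ℂ → Prop := fun m A ↦ ∃ a b c d : Fin m → ℝ, A = ⋃ i, Complex.reProdIm (Set.Icc (a i) (b i)) (Set.Icc (c i) (d i)); let IsHydro : (ℂ → ℂ) → Prop := fun g ↦ Filter.Tendsto (fun w ↦ g w - w) (Filter.cocompact ℂ ⊓ Filter.principal UpperHalfPlane.upperHalfPlaneSet) (nhds 0); let Arc : (ℂ → ℂ) → ℝ → ℝ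 → Set ℂ := fun γ a b ↦ γ '' (Complex.ofReal '' Set.Icc a b); ∃ f : ℝ → ℝ, ContinuousOn f (Set.Ioo 0 1) ∧ ∀ (m : ℕ) (L : Set ℂ) (ψ : Literature.Probability.RandomPlanarGeometry.ConformalEquiv UpperHalfPlane.upperHalfPlaneSet (UpperHalfPlane.upperHalfPlaneSet \ L)) (y : Fin 4 → ℝ), IsHull L → IsRect m L → closure (interior L) = L → IsHydro ψ → StrictMono y → Filter.Tendsto (fun δ : ℝ ↦ P L δ (Arc ψ.boundaryExtension (y 0) (y 1)) (Arc ψ.boundaryExtension (y 2) (y 3))) (nhdsWithin 0 (Set.Ioi 0)) (nhds (f (Literature.Probability.RandomPlanarGeometry.crossRatio y)))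

/-- item stmt-CriticalPhenomena-14541 · support · rank 9 · open · by planner
sources: Lawler2005, Pommerenke1992, Ahlfors1979
[support] Classical input, isolated so that the two glue items are bookkeeping: for every fat
rectilinear hull L (≤ m closed boxes; bounded, closure(L∩ℍ) = L, ℍ∖L simply connected,
closure(interior L) = L) (i) there is a conformal equivalence ψ : ℍ → ℍ∖L with ψ(w) − w → 0 at ∞ (ψ
= g_L⁻¹: Riemann mapping + Schwarz reflection, Lawler2005 Prop 3.36, book p. 69) whose boundary
extension (extendFrom) is continuous on the closed half-plane (∂(ℍ∖L) is a finite union of segments,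
hence locally connected: Carathéodory–Torhorst continuity theorem, Pommerenke1992 Thm 2.1, p. 20),
and (ii) any two such ψ agree on ℍ (uniqueness in Lawler2005 Prop 3.36: a hydrodynamically
normalised conformal automorphism of ℍ is the identity). Known mathematics; the work is
formalisation (Mathlib has no Riemann mapping theorem; the tree's MarkedDomain.exists_isUniformizing
is a named fact of the same grade). Used by WardIntegration (uniformizers of the intermediate hulls;
ψ = id at L = ∅) and by JordanBridge (uniformizers of the approximating hull complements).
[difficulty: L (formalisation)] -/
@[route_item "route-CriticalPhenomena-CardyCapacityWard"]
def HydroUniformizer : Prop :=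
  let IsHull : Set ℂ → Prop := fun A ↦ Bornology.IsBounded A ∧ closure (A ∩ UpperHalfPlane.upperHalfPlaneSet) = A ∧ IsSimplyConnected (UpperHalfPlane.upperHalfPlaneSet \ A); let IsRect : ℕ → Set ℂ → Prop := fun m A ↦ ∃ a b c d : Fin m → ℝ, A = ⋃ i, Complex.reProdIm (Set.Icc (a i) (b i)) (Set.Icc (c i) (d i)); let IsHydro : (ℂ → ℂ) → Prop := fun g ↦ Filter.Tendsto (fun w ↦ g w - w) (Filter.cocompact ℂ ⊓ Filter.principal UpperHalfPlane.upperHalfPlaneSet) (nhds 0); ∀ (m : ℕ) (L : Set ℂ), IsHull L → IsRect m L → closure (interior L) = L → (∃ ψ : Literature.Probability.RandomPlanarGeometry.ConformalEquiv UpperHalfPlane.upperHalfPlaneSet (UpperHalfPlane.upperHalfPlaneSet \ L), IsHydro ψ ∧ ContinuousOn ψ.boundaryExtension (closure UpperHalfPlane.upperHalfPlaneSet)) ∧ ∀ ψ₁ ψ₂ : Literature.Probability.RandomPlanarGeometry.ConformalEquiv UpperHalfPlane.upperHalfPlaneSet (UpperHalfPlane.upperHalfPlaneSet \ L), IsHydro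 ψ₁ → IsHydro ψ₂ → Set.EqOn ψ₁ ψ₂ UpperHalfPlane.upperHalfPlaneSet

/-- item stmt-CriticalPhenomena-14542 · support · rank 9 · open · by planner
sources: Lawler2005, FriedrichWerner2003
[support] GLUE (integration of the face Ward identity): HydroUniformizer → FaceWard →
HalfPlaneMobius → HullCovariance. Proof plan: take f from HalfPlaneMobius. Given (L, ψ, y), fix ONE
frame (m, R, ℓ₀) and a SLAB SCHEDULE ∅ = L₀, L₁, …, L_N = L of fat rectilinear hulls in the frame,
consecutive ones differing by one admissible FaceWard slab of thickness ε_k < ε₀(m,R,ℓ₀,y,η), Σ_k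
ε_k ≤ C(L) (schedule lemma: refine L by the grid of its corner coordinates and add cells outward
from the ground in an order keeping every prefix grounded and pocket-free; FaceWard is symmetric in
(L₁,L₂), so a schedule may also remove slabs). The image marks y stay FIXED; arcs are transported by
the uniformizers ψ_k of HydroUniformizer (ψ₀ = id on ℍ by the uniqueness clause, so the k = 0 arcs
are the real segments of HalfPlaneMobius after `Set.diff_empty`; ψ_N := the given ψ). Summing the N
bounds ηε_k for δ < min_k δ₀(k) puts limsup/liminf of P_δ(ℍ∖L; ψ[y]) within ηC(L) of f(crossRatio y)
for every η > 0. Pure bookkeeping + the combinatorial schedule lemma; no percolation estimate.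
[deps: HydroUniformizer, FaceWard, HalfPlaneMobius] [difficulty: M] -/
@[route_item "route-CriticalPhenomena-CardyCapacityWard"]
def WardIntegration : Prop :=
  HydroUniformizer → FaceWard → HalfPlaneMobius → HullCovariance

/-- item stmt-CriticalPhenomena-14543 · support · rank 9 · open · by planner
why it might fail: Only via a G02 discreteCrossing pathology (largest component / closest-arc rule) for a wild flat-marked Jordan boundary away from the marks, breaking the collar sandwich while hull complements converge.
sources: Pommerenke1992, BollobasRiordan2006, Grimmett1999, CamiaNewman2007, Kesten1982
[support] GLUE into the target: HydroUniformizer → HullCovariance → FlatMarkedCovariance. Proof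
plan: given a flat-marked conformal rectangle R (carrier D ⊆ ℍ bounded Jordan, the four marks real
with upper half-balls inside D) and a uniformizing datum (φ, x), sandwich the G02 crossing event of
D_δ (discreteCrossing, arcs R.arc 0 / R.arc 2) between the crude crossing events of two rectilinear
hull complements ℍ∖L⁺_n ⊇-type / ℍ∖L⁻_n: upper bound = free arcs pushed OUT and marked arcs pushed
IN (any D-crossing contains a crossing of the modified domain between the moved marked arcs — path
surgery, no duality), lower bound conversely; the four flat marks are shared and the junction errors
there are boundary arm events in half-discs (RSW; flatness at the marks is exactly what makes this
cheap); bounded ↔ unbounded by a thin tube from the top free arc to the outside of a box ⊇ D (a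
crossing using the tube traverses it twice: cost e^{−c/w}, uniformly in δ ≤ δ(w)). HullCovariance
gives the limits f(η±_n), η±_n the cross-ratios of the image marks of the approximants (uniformizers
from HydroUniformizer); Carathéodory kernel convergence with uniformly locally connected boundaries
(Pommerenke1 -/
@[route_item "route-CriticalPhenomena-CardyCapacityWard"]
def JordanBridge : Prop :=
  HydroUniformizer → HullCovariance → FlatMarkedCovariance

/-- item stmt-CriticalPhenomena-4624 · assembly · rank 1 · open · by planner
sources: Smirnov2001, CamiaNewman2007
[assembly] FlatMarkedCovariance → TubeReduction → CardyRigidity → CardyFormulaZ2. -/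
@[route_item "route-CriticalPhenomena-CardyCapacityWard"]
def Assembly : Prop :=
  FlatMarkedCovariance → TubeReduction → CardyRigidity → CardyFormulaZ2

/-! D-0027 §2.1 — DECIDING THEOREM (planner-authored via `route open/edit --closes-file`; by planner-rchoice-CriticalPhenomena-CardyCapacit-befcc79e-0 2026-08-16T04:11:01Z):
its hypotheses are this route's items and its conclusion the sub-problem Statement (glue_lint), and it elaborates with this file. -/

@[closes "route-CriticalPhenomena-CardyCapacityWard"] theorem closes (hX : FlatMarkedCovariance) (hTube : TubeReduction) (hRig : CardyRigidity) : _root_.CardyFormulaZ2 := by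
  -- D-0027 §2.1 deciding theorem (route-choice repair 2026-08-16; crux/target hypotheses only).
  -- The target FlatMarkedCovariance is reached inside the route by the support glue chain
  --   WardIntegration : HydroUniformizer → FaceWard → HalfPlaneMobius → HullCovariance,
  --   JordanBridge    : HydroUniformizer → HullCovariance → FlatMarkedCovariance;
  -- here TubeReduction gives X_U = ∃ f ∀ R, HasCrossingLimit and CardyRigidity pins f = F on (0,1).
  obtain ⟨f, hf⟩ := hTube hX
  have hEq : Set.EqOn f Literature.Probability.RandomPlanarGeometry.cardyFunction (Set.Ioo 0 1) :=
    hRig f hf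
  show ∀ R : Literature.Probability.RandomPlanarGeometry.ConformalRectangle,
      R.HasCrossingLimit (Literature.Probability.Percolation.bondDomainCrossingProb R)
        Literature.Probability.RandomPlanarGeometry.cardyFunction
  intro R φ x hφ
  have hη : Literature.Probability.RandomPlanarGeometry.crossRatio x ∈ Set.Ioo (0:ℝ) 1 :=
    Literature.Probability.RandomPlanarGeometry.ConformalRectangle.crossRatio_mem_Ioo_of_isUniformizing hφ
  rw [← hEq hη]
  exact hf R φ x hφ

end Summit.CriticalPhenomena.CardyFormulaZ2.Theses.CardyCapacityWard
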